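import Summits.QuantumFields.BalabanUV.Beta.GAN24.W3ForcingOfZSRoot
import Summits.QuantumFields.BalabanUV.Beta.GAN24.W3ForcingSymZRoot
import Summits.QuantumFields.BalabanUV.Beta.GAN24.WSlotFirstDiffBorder

/-!
# `BalabanUV.Beta.GAN24.W3DriftOfZSRoot` — «T2Drift» (and «T2Shape» ∧ «T2Drift») at `d = 3` modulo ROW W3-F2a, the pin and `hZ0`, AT THE ROOTED BORDER
# `vh₂SAt (toSite r) Lc` (`r ∈ box (3+1) Lc`): decl-by-decl twin of leaf-08's `W3DriftOfZS` (+ §0: END #2's literal form at the rooted border)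
NOT IN PRINT; OUR PROOF ATTEMPT (row owner b2b-balaban-gan24-p1, gen 6; referee r53 (w9) ROOT ALIGNMENT; row (B) of `HOME/b2b-balaban-gan24-p1/SLOT-COVERAGE.md` = the β-lead's
literal `MixedJetTablesPlug.JsBalAn1` / `JsBalAn1Ctr`, road BF-x's family).  [folklore] bookkeeping: the base module's proofs VERBATIM, the border entering only through an1's rooted
lemmas (`hB_an1`/`hBt_an1`, `T2diff_translate_of`, `bracket_translate_block`, `T2UnitSplitBorder …vh₂SAt_of_mix`) and this lineage's rooted rows (`…Root` modules).  Same
theorem names as the base module.  HONEST FRAMING (verbatim): «discharging `BetaPertH` makes Bałaban's UV stability UNCONDITIONAL — a real constructive-QFT result; it is NOT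
the continuum limit and NOT the Clay problem.»  HONEST DEPENDENCY (verbatim): «continuum YM on T⁴ ⇐ BetaPertH ∧ nine spine estimates (0/9 proved); BetaPertH ⇐ (D1) ∧ (D4) ∧
CAP+tail; G-an2-4 gates asym, D1 and NE2/3/4.»  Every row hypothesis of the base module stays a hypothesis; discharges NOTHING of (hW, hWall) by itself; 0 `def`, 0 cite,
0 `def … : Prop`, 0 sorry; NOT «W-slot closed», NEVER «G-an2-4 closed», NOT (CONV-C) for `G_k/H_k`; NOT BetaPertH, NOT continuum, NOT Clay.
v1.1 (gen 8; referee ref1 r86 (i) / r90 (iii)): the import-only edge on the base module `W3DriftOfZS` is DROPPED — no declaration of it is used here (every name resolves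
through the three `…Root` imports); every declaration below is byte-identical to v1 (p219422); the one importer `W3TowerOfZSRoot` reaches `W3DriftOfZS` via `W3TowerOfZS`.
-/

noncomputable section

open Literature.MathematicalPhysics.QuantumFieldTheory
open Literature.MathematicalPhysics.QuantumFieldTheory.Balaban1983to89
open Literature.MathematicalPhysics.QuantumFieldTheory.Balaban1983to89.Beta
open AffineAveraging (box toSite)
open ExpKernelCalculus (MKer shiftK)
open OneStepResolventKernel (Fib)
open OneStepKernelFamily (KInvStep)
open StepJetData (mfNeg)
open SecondOrderResponse (W2SymOfK LocStencilFM)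
open BalabanCompositeJets (LocStencil₂)
open BalabanStepJetsSucc (mmRead)
open BalabanStepW2 (K3OfK Spure M1 M2Of T2Of)
open AveragingMixedJetTables (vh₂SAt mixFFAt)
open Summit.QuantumFields.BalabanUV.Beta.HessKerDressedUnits (unitK unitS)
open Summit.QuantumFields.BalabanUV.Beta.SecondOrderUnits (unitM unitS₂ unitM₂)
open Summit.QuantumFields.BalabanUV.Beta.MixedJetTablesPlug (hmix_an1 hmixt_an1 hB_an1 hBt_an1)
open Summit.QuantumFields.BalabanUV.Beta.GAN24.CombesThomas (sfStep smStep)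
open Summit.QuantumFields.BalabanUV.Beta.GAN24.StencilSlotOfE3 (one_le_of_two_le)
open Summit.QuantumFields.BalabanUV.Beta.GAN24.Push4Iter (BiTab)
open Summit.QuantumFields.BalabanUV.Beta.GAN24.AffineUnroll (transport)
open Summit.QuantumFields.BalabanUV.Beta.GAN24.BiStencilZeroMode (zmode)
open Summit.QuantumFields.BalabanUV.Beta.GAN24.T2RecursionAffine (lin4)
open Summit.QuantumFields.BalabanUV.Beta.GAN24.KSlotAssembly (convCKWall_holds)
open Summit.QuantumFields.BalabanUV.Beta.GAN24.T2SlotCovariance (T2diff_translate_of)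
open Summit.QuantumFields.BalabanUV.Beta.GAN24.T2OfBracketBlockCovariance (bracket_translate_block)
open Summit.QuantumFields.BalabanUV.Beta.GAN24.T2UnitSplitBorder (unitS₂_T2Of_sub_eq_transport_add_sum_vh₂SAt_of_mix)
open Summit.QuantumFields.BalabanUV.Beta.GAN24.TransportIrrelevant (hTirr_three_slot)
open Summit.QuantumFields.BalabanUV.Beta.GAN24.TransportIrrelevantSym (hTirr_three_symZ_slot)
open Summit.QuantumFields.BalabanUV.Beta.GAN24.W3ForcingSymZRoot (forcing_zfreeSym_of_source)
open Summit.QuantumFields.BalabanUV.Beta.GAN24.TransportRows (inv_natCast_nonneg inv_natCast_lt_one)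
open Summit.QuantumFields.BalabanUV.Beta.GAN24.WSlotT2OfPieces (rate_of_rows cauchy_of_rate sup_of_locStencil₂)
open Summit.QuantumFields.BalabanUV.Beta.GAN24.WSlotFirstDiffBorder (hD0_pair)
open Summit.QuantumFields.BalabanUV.Beta.GAN24.WSlotForcingZeroModeW3Root (hZf_of_hZ_W3)
open Summit.QuantumFields.BalabanUV.Beta.GAN24.WSlotMixedShape (mixFFAt_hfm mixFFAt_hm)
open Summit.QuantumFields.BalabanUV.Beta.GAN24.W3SourceRowsEndRoot (hb_three_at)
open Summit.QuantumFields.BalabanUV.Beta.GAN24.T2ShapeThreeOfF2aRoot (t2Shape_three_of_F2a t2Shape_three_of_F2a_symZ t2Shape_three_an1_of_F2a_symZ)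
open Summit.QuantumFields.BalabanUV.Beta.GAN24.W3ForcingOfZSRoot (hf_three_of_F2a hf_three_of_F2asym)

namespace Summit.QuantumFields.BalabanUV.Beta.GAN24.W3DriftOfZSRoot

section LiteralAt

variable {d : ℕ} {Lc : ℕ} [NeZero Lc] {r : Fin (d + 1) → ℕ}

/-- [folklore] **END #2 (`WSlotT2OfPieces.t2Drift_of_rows`, one-step ∕ Cauchy ∕ sup forms) AT THE ROOTED BORDER `vh₂SAt (toSite r) Lc`** — pure row algebra, any root. -/
theorem t2Drift_of_rows_at (cE cVH cΛ cE₂ cB : ℝ) (Tc : Fin 4 → Fin 4 → Fin 4 → Fin 4 → ℝ)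
    (mixFF : Fin (d + 1) → (Fin (d + 1) → ℤ) → Fin (d + 1) → (Fin (d + 1) → ℤ) → MKer (d + 1) (Fib d))
    (f : ℕ → Fin (d + 1) → (Fin (d + 1) → ℤ) → Fin (d + 1) → (Fin (d + 1) → ℤ) → MKer (d + 1) (Fib d))
    (P : ℕ → ℕ → (Fin (d + 1) → (Fin (d + 1) → ℤ) → Fin (d + 1) → (Fin (d + 1) → ℤ) → MKer (d + 1) (Fib d)) → Fin (d + 1) → (Fin (d + 1) → ℤ) → Fin (d + 1) → (Fin (d + 1) → ℤ) → MKer (d + 1) (Fib d))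
    (Zfree : (Fin (d + 1) → (Fin (d + 1) → ℤ) → Fin (d + 1) → (Fin (d + 1) → ℤ) → MKer (d + 1) (Fib d)) → Prop)
    (mom : (Fin (d + 1) → (Fin (d + 1) → ℤ) → Fin (d + 1) → (Fin (d + 1) → ℤ) → MKer (d + 1) (Fib d)) → ℝ)
    {δin δT CT' ρ θ Cf C₀ : ℝ} (hδT : 0 < δT) (hCT' : 0 ≤ CT') (hρ0 : 0 ≤ ρ) (hρ1 : ρ < 1) (hθ0 : 0 ≤ θ) (hθ1 : θ < 1)
    (hsplit : ∀ n, (fun κ u κ' u' => unitS₂ (sfStep Lc (n + 1)) (smStep d Lc (n + 1)) (T2Of d Lc cE cVH cΛ cE₂ cB Tc (vh₂SAt (toSite r) Lc) mixFF (n + 1)) κ u κ' u' - unitS₂ (sfStep Lc n) (smStep d Lc n) (T2Of d Lc cE cVH cΛ cE₂ cB Tc (vh₂SAt (toSite r) Lc) mixFF n) κ u κ' u') =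
      P 0 n (fun κ u κ' u' => unitS₂ (sfStep Lc 1) (smStep d Lc 1) (T2Of d Lc cE cVH cΛ cE₂ cB Tc (vh₂SAt (toSite r) Lc) mixFF 1) κ u κ' u' - unitS₂ (sfStep Lc 0) (smStep d Lc 0) (T2Of d Lc cE cVH cΛ cE₂ cB Tc (vh₂SAt (toSite r) Lc) mixFF 0) κ u κ' u')
        + ∑ i ∈ Finset.range n, P (i + 1) (n - 1 - i) (f i))
    (hTirr : ∀ (m k : ℕ) (X : Fin (d + 1) → (Fin (d + 1) → ℤ) → Fin (d + 1) → (Fin (d + 1) → ℤ) → MKer (d + 1) (Fib d)) (C : ℝ),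
      0 ≤ C → LocStencil₂ X C δin → Zfree X → mom X ≤ C → LocStencil₂ (P m k X) (CT' * C * ρ ^ k) δT)
    (hf : ∀ m, LocStencil₂ (f m) (Cf * θ ^ m) δin ∧ mom (f m) ≤ Cf * θ ^ m) (hZf : ∀ m, Zfree (f m))
    (h0 : LocStencil₂ (fun κ u κ' u' => unitS₂ (sfStep Lc 1) (smStep d Lc 1) (T2Of d Lc cE cVH cΛ cE₂ cB Tc (vh₂SAt (toSite r) Lc) mixFF 1) κ u κ' u' - unitS₂ (sfStep Lc 0) (smStep d Lc 0) (T2Of d Lc cE cVH cΛ cE₂ cB Tc (vh₂SAt (toSite r) Lc) mixFF 0) κ u κ' u') C₀ δin ∧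
      mom (fun κ u κ' u' => unitS₂ (sfStep Lc 1) (smStep d Lc 1) (T2Of d Lc cE cVH cΛ cE₂ cB Tc (vh₂SAt (toSite r) Lc) mixFF 1) κ u κ' u' - unitS₂ (sfStep Lc 0) (smStep d Lc 0) (T2Of d Lc cE cVH cΛ cE₂ cB Tc (vh₂SAt (toSite r) Lc) mixFF 0) κ u κ' u') ≤ C₀)
    (hZ0 : Zfree (fun κ u κ' u' => unitS₂ (sfStep Lc 1) (smStep d Lc 1) (T2Of d Lc cE cVH cΛ cE₂ cB Tc (vh₂SAt (toSite r) Lc) mixFF 1) κ u κ' u' - unitS₂ (sfStep Lc 0) (smStep d Lc 0) (T2Of d Lc cE cVH cΛ cE₂ cB Tc (vh₂SAt (toSite r) Lc) mixFF 0) κ u κ' u')) :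
    ∃ c ϑ : ℝ, 0 ≤ c ∧ 0 < ϑ ∧ ϑ < 1 ∧
      (∀ n, LocStencil₂ (fun κ u κ' u' => unitS₂ (sfStep Lc (n + 1)) (smStep d Lc (n + 1)) (T2Of d Lc cE cVH cΛ cE₂ cB Tc (vh₂SAt (toSite r) Lc) mixFF (n + 1)) κ u κ' u' - unitS₂ (sfStep Lc n) (smStep d Lc n) (T2Of d Lc cE cVH cΛ cE₂ cB Tc (vh₂SAt (toSite r) Lc) mixFF n) κ u κ' u') (c * ϑ ^ n) δT) ∧
      (∀ k j, LocStencil₂ (fun κ u κ' u' => unitS₂ (sfStep Lc (k + j)) (smStep d Lc (k + j)) (T2Of d Lc cE cVH cΛ cE₂ cB Tc (vh₂SAt (toSite r) Lc) mixFF (k + j)) κ u κ' u' - unitS₂ (sfStep Lc k) (smStep d Lc k) (T2Of d Lc cE cVH cΛ cE₂ cB Tc (vh₂SAt (toSite r) Lc) mixFF k) κ u κ' u') (c * (1 - ϑ)⁻¹ * ϑ ^ k) δT) ∧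
      (∀ n κ u κ' u' x z a b, |unitS₂ (sfStep Lc (n + 1)) (smStep d Lc (n + 1)) (T2Of d Lc cE cVH cΛ cE₂ cB Tc (vh₂SAt (toSite r) Lc) mixFF (n + 1)) κ u κ' u' x z a b - unitS₂ (sfStep Lc n) (smStep d Lc n) (T2Of d Lc cE cVH cΛ cE₂ cB Tc (vh₂SAt (toSite r) Lc) mixFF n) κ u κ' u' x z a b| ≤ c * ϑ ^ n) := by
  obtain ⟨c, ϑ, hc, hϑ0, hϑ1, hD⟩ := rate_of_rows
    (fun n => fun κ u κ' u' => unitS₂ (sfStep Lc (n + 1)) (smStep d Lc (n + 1)) (T2Of d Lc cE cVH cΛ cE₂ cB Tc (vh₂SAt (toSite r) Lc) mixFF (n + 1)) κ u κ' u' - unitS₂ (sfStep Lc n) (smStep d Lc n) (T2Of d Lc cE cVH cΛ cE₂ cB Tc (vh₂SAt (toSite r) Lc) mixFF n) κ u κ' u')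
    f P Zfree mom hCT' hρ0 hρ1 hθ0 hθ1 hsplit hTirr hf hZf h0 hZ0
  refine ⟨c, ϑ, hc, hϑ0, hϑ1, hD, fun k j => ?_, fun n κ u κ' u' x z a b => ?_⟩
  · exact cauchy_of_rate (fun n => unitS₂ (sfStep Lc n) (smStep d Lc n) (T2Of d Lc cE cVH cΛ cE₂ cB Tc (vh₂SAt (toSite r) Lc) mixFF n)) hc hϑ0.le hϑ1 hD k j
  · exact sup_of_locStencil₂ hδT.le (hD n) κ u κ' u' x z a b

end LiteralAt

/-! ## §1 Generic mixed table: END #2 modulo ROW W3-F2a, ROW W3-F4d's pin half and the pin -/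

section Three

variable {Lc : ℕ} [NeZero Lc] {r : Fin (3 + 1) → ℕ}

/-- **END #2 COMPOSED BY NAME, generic mixed table, record-`Zfree` forms**: at `d = 3`, `Lc ≥ 2`, UNDER THE PIN, for a mixed table with ROWS-MIX (`hmix hδ₄ hfm hm`) and an2's block covariance `hmixt`: if every source `b♮_m` is `Zfree` (ROW W3-F2a, record form: jointly `Lc`-covariant ∧ cell ff zero mode) and the first difference `T♮₁ − T♮₀` is `Zfree` (ROW W3-F4d's pin half), th … -/
theorem t2Drift_three_of_F2a_Z0 (hLc : 2 ≤ Lc) (hr : r ∈ box (3 + 1) Lc) (cE cVH cΛ cE₂ cB : ℝ) (Tc : Fin 4 → Fin 4 → Fin 4 → Fin 4 → ℝ)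
    {mixFF : BiTab 3} {CM₂ δ₄ : ℝ} (hmix : LocStencilFM Lc mixFF CM₂ δ₄) (hδ₄ : 0 < δ₄)
    (hfm : ∀ κ u ρ w x z (α μ' : Fin (3 + 1)), mixFF κ u ρ w x z (Sum.inl α) (Sum.inr μ') = 0)
    (hm : ∀ κ u ρ w x z (μ' : Fin (3 + 1)) (b : Fib 3), mixFF κ u ρ w x z (Sum.inr μ') b = 0)
    (hmixt : ∀ (κ : Fin (3 + 1)) (u : Fin (3 + 1) → ℤ) (ρ : Fin (3 + 1)) (w t : Fin (3 + 1) → ℤ),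
      mixFF κ (u + (Lc : ℤ) • t) ρ (w + t) = shiftK (-((Lc : ℤ) • t)) (mixFF κ u ρ w))
    (hpin : |cE₂| ≤ (Lc : ℝ) ^ (2 * (3 + 1)))
    (hZ : ∀ m : ℕ, (∀ κ u κ' u' t, (fun κ u κ' u' =>
        (cE₂ * (Lc : ℝ) ^ (2 * (3 + 1))) •
            mmRead Lc (K3OfK (unitK (sfStep Lc m) (smStep 3 Lc m) (KInvStep (d := 3) Lc m)) Lc
              (unitS (sfStep Lc m) (smStep 3 Lc m) (Spure 3 Lc cE cVH cΛ m)) (unitM (sfStep Lc m) (smStep 3 Lc m) (M1 3 Lc cΛ m))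
              (W2SymOfK (unitK (sfStep Lc m) (smStep 3 Lc m) (KInvStep (d := 3) Lc m)) Lc
                (unitS (sfStep Lc m) (smStep 3 Lc m) (Spure 3 Lc cE cVH cΛ m)) (unitM (sfStep Lc m) (smStep 3 Lc m) (M1 3 Lc cΛ m)) 0
                (unitM₂ (sfStep Lc m) (smStep 3 Lc m) (M2Of 3 Lc mixFF m))) κ u κ' u')
          + cB • mfNeg ((vh₂SAt (toSite r) Lc) κ u κ' u')) κ (u + (Lc : ℤ) • t) κ' (u' + (Lc : ℤ) • t) = shiftK (-((Lc : ℤ) • t)) ((fun κ u κ' u' =>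
        (cE₂ * (Lc : ℝ) ^ (2 * (3 + 1))) •
            mmRead Lc (K3OfK (unitK (sfStep Lc m) (smStep 3 Lc m) (KInvStep (d := 3) Lc m)) Lc
              (unitS (sfStep Lc m) (smStep 3 Lc m) (Spure 3 Lc cE cVH cΛ m)) (unitM (sfStep Lc m) (smStep 3 Lc m) (M1 3 Lc cΛ m))
              (W2SymOfK (unitK (sfStep Lc m) (smStep 3 Lc m) (KInvStep (d := 3) Lc m)) Lc
                (unitS (sfStep Lc m) (smStep 3 Lc m) (Spure 3 Lc cE cVH cΛ m)) (unitM (sfStep Lc m) (smStep 3 Lc m) (M1 3 Lc cΛ m)) 0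
                (unitM₂ (sfStep Lc m) (smStep 3 Lc m) (M2Of 3 Lc mixFF m))) κ u κ' u')
          + cB • mfNeg ((vh₂SAt (toSite r) Lc) κ u κ' u')) κ u κ' u')) ∧
      (∀ κ κ' κ₁ κ₂, zmode Lc (fun κ u κ' u' =>
        (cE₂ * (Lc : ℝ) ^ (2 * (3 + 1))) •
            mmRead Lc (K3OfK (unitK (sfStep Lc m) (smStep 3 Lc m) (KInvStep (d := 3) Lc m)) Lc
              (unitS (sfStep Lc m) (smStep 3 Lc m) (Spure 3 Lc cE cVH cΛ m)) (unitM (sfStep Lc m) (smStep 3 Lc m) (M1 3 Lc cΛ m))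
              (W2SymOfK (unitK (sfStep Lc m) (smStep 3 Lc m) (KInvStep (d := 3) Lc m)) Lc
                (unitS (sfStep Lc m) (smStep 3 Lc m) (Spure 3 Lc cE cVH cΛ m)) (unitM (sfStep Lc m) (smStep 3 Lc m) (M1 3 Lc cΛ m)) 0
                (unitM₂ (sfStep Lc m) (smStep 3 Lc m) (M2Of 3 Lc mixFF m))) κ u κ' u')
          + cB • mfNeg ((vh₂SAt (toSite r) Lc) κ u κ' u')) κ κ' (Sum.inl κ₁) (Sum.inl κ₂) = 0))
    (hZ0 : (∀ κ u κ' u' t, (fun κ u κ' u' => unitS₂ (sfStep Lc 1) (smStep 3 Lc 1) (T2Of 3 Lc cE cVH cΛ cE₂ cB Tc (vh₂SAt (toSite r) Lc) mixFF 1) κ u κ' u' - unitS₂ (sfStep Lc 0) (smStep 3 Lc 0) (T2Of 3 Lc cE cVH cΛ cE₂ cB Tc (vh₂SAt (toSite r) Lc) mixFF 0) κ u κ' u') κ (u + (Lc : ℤ) • t) κ' (u' + (Lc : ℤ) • t) = shiftK (-((Lc : ℤ) • t)) ((fun κ u κ' u' => unitS₂ (sfStep Lc 1) (smStep 3 Lc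 1) (T2Of 3 Lc cE cVH cΛ cE₂ cB Tc (vh₂SAt (toSite r) Lc) mixFF 1) κ u κ' u' - unitS₂ (sfStep Lc 0) (smStep 3 Lc 0) (T2Of 3 Lc cE cVH cΛ cE₂ cB Tc (vh₂SAt (toSite r) Lc) mixFF 0) κ u κ' u') κ u κ' u')) ∧
      (∀ κ κ' κ₁ κ₂, zmode Lc (fun κ u κ' u' => unitS₂ (sfStep Lc 1) (smStep 3 Lc 1) (T2Of 3 Lc cE cVH cΛ cE₂ cB Tc (vh₂SAt (toSite r) Lc) mixFF 1) κ u κ' u' - unitS₂ (sfStep Lc 0) (smStep 3 Lc 0) (T2Of 3 Lc cE cVH cΛ cE₂ cB Tc (vh₂SAt (toSite r) Lc) mixFF 0) κ u κ' u') κ κ' (Sum.inl κ₁) (Sum.inl κ₂) = 0)) :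
    ∃ c ϑ δT : ℝ, 0 ≤ c ∧ 0 < ϑ ∧ ϑ < 1 ∧ 0 < δT ∧
      (∀ n, LocStencil₂ (fun κ u κ' u' => unitS₂ (sfStep Lc (n + 1)) (smStep 3 Lc (n + 1)) (T2Of 3 Lc cE cVH cΛ cE₂ cB Tc (vh₂SAt (toSite r) Lc) mixFF (n + 1)) κ u κ' u' - unitS₂ (sfStep Lc n) (smStep 3 Lc n) (T2Of 3 Lc cE cVH cΛ cE₂ cB Tc (vh₂SAt (toSite r) Lc) mixFF n) κ u κ' u') (c * ϑ ^ n) δT) ∧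
      (∀ k j, LocStencil₂ (fun κ u κ' u' => unitS₂ (sfStep Lc (k + j)) (smStep 3 Lc (k + j)) (T2Of 3 Lc cE cVH cΛ cE₂ cB Tc (vh₂SAt (toSite r) Lc) mixFF (k + j)) κ u κ' u' - unitS₂ (sfStep Lc k) (smStep 3 Lc k) (T2Of 3 Lc cE cVH cΛ cE₂ cB Tc (vh₂SAt (toSite r) Lc) mixFF k) κ u κ' u') (c * (1 - ϑ)⁻¹ * ϑ ^ k) δT) ∧
      (∀ n κ u κ' u' x z a b, |unitS₂ (sfStep Lc (n + 1)) (smStep 3 Lc (n + 1)) (T2Of 3 Lc cE cVH cΛ cE₂ cB Tc (vh₂SAt (toSite r) Lc) mixFF (n + 1)) κ u κ' u' x z a b - unitS₂ (sfStep Lc n) (smStep 3 Lc n) (T2Of 3 Lc cE cVH cΛ cE₂ cB Tc (vh₂SAt (toSite r) Lc) mixFF n) κ u κ' u' x z a b| ≤ c * ϑ ^ n) := by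
  have hLc1 : 1 ≤ Lc := one_le_of_two_le hLc
  obtain ⟨C, δ, cK, θK, hδ, -, -, hK, -⟩ := convCKWall_holds (Lc := Lc) hLc
  obtain ⟨Cf, θ, δf, hCf, hθ0, hθ1, hδf, hf⟩ := hf_three_of_F2a hLc hr cE cVH cΛ cE₂ cB Tc hmix hδ₄ hfm hm hpin hZ
  obtain ⟨C₀, δ₀, hδ₀, h0⟩ := hD0_pair (d := 3) hLc1 cE cVH cΛ cE₂ cB Tc (hB_an1 hLc1 hr) ⟨CM₂, δ₄, hδ₄, hmix⟩
  obtain ⟨Cb, δb, hCb, hδb, hb⟩ := hb_three_at hLc hr cE cVH cΛ cE₂ cB hmix hδ₄ hfm hm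
  obtain ⟨CT', δT, hCT', hδT, -, hTi⟩ := hTirr_three_slot hLc1 hK hδ cE₂ (lt_min hδf hδ₀) (fun _ => (0 : ℝ))
  obtain ⟨c, ϑ, hc, hϑ0, hϑ1, h1, h2, h3⟩ := t2Drift_of_rows_at (d := 3) cE cVH cΛ cE₂ cB Tc mixFF
    (fun m => ((lin4 (cE₂ * (Lc : ℝ) ^ (2 * (3 + 1))) (unitK (sfStep Lc (m + 1)) (smStep 3 Lc (m + 1)) (KInvStep (d := 3) Lc (m + 1))) Lc
              (unitS₂ (sfStep Lc m) (smStep 3 Lc m) (T2Of 3 Lc cE cVH cΛ cE₂ cB Tc (vh₂SAt (toSite r) Lc) mixFF m))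
          - lin4 (cE₂ * (Lc : ℝ) ^ (2 * (3 + 1))) (unitK (sfStep Lc m) (smStep 3 Lc m) (KInvStep (d := 3) Lc m)) Lc
              (unitS₂ (sfStep Lc m) (smStep 3 Lc m) (T2Of 3 Lc cE cVH cΛ cE₂ cB Tc (vh₂SAt (toSite r) Lc) mixFF m)))
        + ((fun κ u κ' u' =>
        (cE₂ * (Lc : ℝ) ^ (2 * (3 + 1))) •
            mmRead Lc (K3OfK (unitK (sfStep Lc (m + 1)) (smStep 3 Lc (m + 1)) (KInvStep (d := 3) Lc (m + 1))) Lc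
              (unitS (sfStep Lc (m + 1)) (smStep 3 Lc (m + 1)) (Spure 3 Lc cE cVH cΛ (m + 1))) (unitM (sfStep Lc (m + 1)) (smStep 3 Lc (m + 1)) (M1 3 Lc cΛ (m + 1)))
              (W2SymOfK (unitK (sfStep Lc (m + 1)) (smStep 3 Lc (m + 1)) (KInvStep (d := 3) Lc (m + 1))) Lc
                (unitS (sfStep Lc (m + 1)) (smStep 3 Lc (m + 1)) (Spure 3 Lc cE cVH cΛ (m + 1))) (unitM (sfStep Lc (m + 1)) (smStep 3 Lc (m + 1)) (M1 3 Lc cΛ (m + 1))) 0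
                (unitM₂ (sfStep Lc (m + 1)) (smStep 3 Lc (m + 1)) (M2Of 3 Lc mixFF (m + 1)))) κ u κ' u')
          + cB • mfNeg ((vh₂SAt (toSite r) Lc) κ u κ' u'))
          - (fun κ u κ' u' =>
        (cE₂ * (Lc : ℝ) ^ (2 * (3 + 1))) •
            mmRead Lc (K3OfK (unitK (sfStep Lc m) (smStep 3 Lc m) (KInvStep (d := 3) Lc m)) Lc
              (unitS (sfStep Lc m) (smStep 3 Lc m) (Spure 3 Lc cE cVH cΛ m)) (unitM (sfStep Lc m) (smStep 3 Lc m) (M1 3 Lc cΛ m))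
              (W2SymOfK (unitK (sfStep Lc m) (smStep 3 Lc m) (KInvStep (d := 3) Lc m)) Lc
                (unitS (sfStep Lc m) (smStep 3 Lc m) (Spure 3 Lc cE cVH cΛ m)) (unitM (sfStep Lc m) (smStep 3 Lc m) (M1 3 Lc cΛ m)) 0
                (unitM₂ (sfStep Lc m) (smStep 3 Lc m) (M2Of 3 Lc mixFF m))) κ u κ' u')
          + cB • mfNeg ((vh₂SAt (toSite r) Lc) κ u κ' u')))))
    (fun m k => transport (fun j => lin4 (cE₂ * (Lc : ℝ) ^ (2 * (3 + 1))) (unitK (sfStep Lc j) (smStep 3 Lc j) (KInvStep (d := 3) Lc j)) Lc) (m + 1) k)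
    (fun X => (∀ κ u κ' u' t, X κ (u + (Lc : ℤ) • t) κ' (u' + (Lc : ℤ) • t) = shiftK (-((Lc : ℤ) • t)) (X κ u κ' u')) ∧
      (∀ κ κ' κ₁ κ₂, zmode Lc X κ κ' (Sum.inl κ₁) (Sum.inl κ₂) = 0))
    (fun _ => (0 : ℝ)) hδT hCT' inv_natCast_nonneg (inv_natCast_lt_one hLc) hθ0 hθ1
    (fun n => unitS₂_T2Of_sub_eq_transport_add_sum_vh₂SAt_of_mix cE cVH cΛ cE₂ cB Tc mixFF hLc1 hr ⟨CM₂, δ₄, hδ₄, hmix⟩ n)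
    (fun m k X C' hC hX hZX hmX => hTi hpin (m + 1) k X C' hC hX hZX hmX)
    (hf (min_le_left _ _))
    (fun m => hZf_of_hZ_W3 (d := 3) hLc1 hr cE cVH cΛ cE₂ cB Tc ⟨CM₂, δ₄, hδ₄, hmix⟩ hmixt hδb (fun j => (hb le_rfl j).1) hZ m)
    (h0 _ (min_le_right _ _)) hZ0
  exact ⟨c, ϑ, δT, hc, hϑ0, hϑ1, hδT, h1, h2, h3⟩

/-- **END #2 COMPOSED BY NAME, generic mixed table, FROM THE CELL ZERO MODES ALONE** (record currency): as `t2Drift_three_of_F2a_Z0`, taking ROW W3-F2a as `∀ m κ κ′ κ₁ κ₂, zmode Lc b♮_m κ κ′ ff = 0` and ROW W3-F4d's pin half as `∀ κ κ′ κ₁ κ₂, zmode Lc (T♮₁ − T♮₀) κ κ′ ff = 0`; the covariance conjuncts are leaf-11's `bracket_translate_block_base` and leaf-19's `T2diff_translate` … -/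
theorem t2Drift_three_of_F2acell_Z0cell (hLc : 2 ≤ Lc) (hr : r ∈ box (3 + 1) Lc) (cE cVH cΛ cE₂ cB : ℝ) (Tc : Fin 4 → Fin 4 → Fin 4 → Fin 4 → ℝ)
    {mixFF : BiTab 3} {CM₂ δ₄ : ℝ} (hmix : LocStencilFM Lc mixFF CM₂ δ₄) (hδ₄ : 0 < δ₄)
    (hfm : ∀ κ u ρ w x z (α μ' : Fin (3 + 1)), mixFF κ u ρ w x z (Sum.inl α) (Sum.inr μ') = 0)
    (hm : ∀ κ u ρ w x z (μ' : Fin (3 + 1)) (b : Fib 3), mixFF κ u ρ w x z (Sum.inr μ') b = 0)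
    (hmixt : ∀ (κ : Fin (3 + 1)) (u : Fin (3 + 1) → ℤ) (ρ : Fin (3 + 1)) (w t : Fin (3 + 1) → ℤ),
      mixFF κ (u + (Lc : ℤ) • t) ρ (w + t) = shiftK (-((Lc : ℤ) • t)) (mixFF κ u ρ w))
    (hpin : |cE₂| ≤ (Lc : ℝ) ^ (2 * (3 + 1)))
    (hZ : ∀ m : ℕ, (∀ κ κ' κ₁ κ₂, zmode Lc (fun κ u κ' u' =>
        (cE₂ * (Lc : ℝ) ^ (2 * (3 + 1))) •
            mmRead Lc (K3OfK (unitK (sfStep Lc m) (smStep 3 Lc m) (KInvStep (d := 3) Lc m)) Lc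
              (unitS (sfStep Lc m) (smStep 3 Lc m) (Spure 3 Lc cE cVH cΛ m)) (unitM (sfStep Lc m) (smStep 3 Lc m) (M1 3 Lc cΛ m))
              (W2SymOfK (unitK (sfStep Lc m) (smStep 3 Lc m) (KInvStep (d := 3) Lc m)) Lc
                (unitS (sfStep Lc m) (smStep 3 Lc m) (Spure 3 Lc cE cVH cΛ m)) (unitM (sfStep Lc m) (smStep 3 Lc m) (M1 3 Lc cΛ m)) 0
                (unitM₂ (sfStep Lc m) (smStep 3 Lc m) (M2Of 3 Lc mixFF m))) κ u κ' u')
          + cB • mfNeg ((vh₂SAt (toSite r) Lc) κ u κ' u')) κ κ' (Sum.inl κ₁) (Sum.inl κ₂) = 0))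
    (hZ0 : (∀ κ κ' κ₁ κ₂, zmode Lc (fun κ u κ' u' => unitS₂ (sfStep Lc 1) (smStep 3 Lc 1) (T2Of 3 Lc cE cVH cΛ cE₂ cB Tc (vh₂SAt (toSite r) Lc) mixFF 1) κ u κ' u' - unitS₂ (sfStep Lc 0) (smStep 3 Lc 0) (T2Of 3 Lc cE cVH cΛ cE₂ cB Tc (vh₂SAt (toSite r) Lc) mixFF 0) κ u κ' u') κ κ' (Sum.inl κ₁) (Sum.inl κ₂) = 0)) :
    ∃ c ϑ δT : ℝ, 0 ≤ c ∧ 0 < ϑ ∧ ϑ < 1 ∧ 0 < δT ∧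
      (∀ n, LocStencil₂ (fun κ u κ' u' => unitS₂ (sfStep Lc (n + 1)) (smStep 3 Lc (n + 1)) (T2Of 3 Lc cE cVH cΛ cE₂ cB Tc (vh₂SAt (toSite r) Lc) mixFF (n + 1)) κ u κ' u' - unitS₂ (sfStep Lc n) (smStep 3 Lc n) (T2Of 3 Lc cE cVH cΛ cE₂ cB Tc (vh₂SAt (toSite r) Lc) mixFF n) κ u κ' u') (c * ϑ ^ n) δT) ∧
      (∀ k j, LocStencil₂ (fun κ u κ' u' => unitS₂ (sfStep Lc (k + j)) (smStep 3 Lc (k + j)) (T2Of 3 Lc cE cVH cΛ cE₂ cB Tc (vh₂SAt (toSite r) Lc) mixFF (k + j)) κ u κ' u' - unitS₂ (sfStep Lc k) (smStep 3 Lc k) (T2Of 3 Lc cE cVH cΛ cE₂ cB Tc (vh₂SAt (toSite r) Lc) mixFF k) κ u κ' u') (c * (1 - ϑ)⁻¹ * ϑ ^ k) δT) ∧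
      (∀ n κ u κ' u' x z a b, |unitS₂ (sfStep Lc (n + 1)) (smStep 3 Lc (n + 1)) (T2Of 3 Lc cE cVH cΛ cE₂ cB Tc (vh₂SAt (toSite r) Lc) mixFF (n + 1)) κ u κ' u' x z a b - unitS₂ (sfStep Lc n) (smStep 3 Lc n) (T2Of 3 Lc cE cVH cΛ cE₂ cB Tc (vh₂SAt (toSite r) Lc) mixFF n) κ u κ' u' x z a b| ≤ c * ϑ ^ n) :=
  t2Drift_three_of_F2a_Z0 hLc hr cE cVH cΛ cE₂ cB Tc hmix hδ₄ hfm hm hmixt hpin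
    (fun m => ⟨fun κ u κ' u' t => bracket_translate_block (d := 3) (one_le_of_two_le hLc) cE cVH cΛ hmixt (hBt_an1 (one_le_of_two_le hLc) (toSite r)) cE₂ cB m κ u κ' u' t, hZ m⟩)
    ⟨fun κ u κ' u' t => T2diff_translate_of (d := 3) (one_le_of_two_le hLc) cE cVH cΛ cE₂ cB Tc (hBt_an1 (one_le_of_two_le hLc) (toSite r)) hmixt 0 κ u κ' u' t, hZ0⟩

/-- **END #2 COMPOSED BY NAME, generic mixed table, IN THE BOND-SYMMETRISED CURRENCY `Zfree := ZfreeSym`** (leaf-12-g21's THIRD REPAIR of the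
F4d ⊥, l.10219 — the currency in which ROW W3-F4d's pin half HOLDS at the exact pin for EVERY `Tc`, `FirstDiffSymCharge.hZ0_symZ_three`): UNDER THE
PIN, if every source `b♮_m` has vanishing bond-symmetrised cell ff charge (ROW W3-F2a, sym form) and so has the first difference `T♮₁ − T♮₀` (ROW
W3-F4d's pin half, sym form), then «T2Drift» holds — F3b by leaf-12's `TransportIrrelevantSym.hTirr_three_symZ_slot`, F4b by THIS lineage's
`W3ForcingOfZS.hf_three_of_F2asym`, F2b by `W3ForcingSymZ.forcing_zfreeSym_of_source`, the covariance conjuncts by `hmixt` as above. -/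
theorem t2Drift_three_of_F2asym_Z0sym (hLc : 2 ≤ Lc) (hr : r ∈ box (3 + 1) Lc) (cE cVH cΛ cE₂ cB : ℝ) (Tc : Fin 4 → Fin 4 → Fin 4 → Fin 4 → ℝ)
    {mixFF : BiTab 3} {CM₂ δ₄ : ℝ} (hmix : LocStencilFM Lc mixFF CM₂ δ₄) (hδ₄ : 0 < δ₄)
    (hfm : ∀ κ u ρ w x z (α μ' : Fin (3 + 1)), mixFF κ u ρ w x z (Sum.inl α) (Sum.inr μ') = 0)
    (hm : ∀ κ u ρ w x z (μ' : Fin (3 + 1)) (b : Fib 3), mixFF κ u ρ w x z (Sum.inr μ') b = 0)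
    (hmixt : ∀ (κ : Fin (3 + 1)) (u : Fin (3 + 1) → ℤ) (ρ : Fin (3 + 1)) (w t : Fin (3 + 1) → ℤ),
      mixFF κ (u + (Lc : ℤ) • t) ρ (w + t) = shiftK (-((Lc : ℤ) • t)) (mixFF κ u ρ w))
    (hpin : |cE₂| ≤ (Lc : ℝ) ^ (2 * (3 + 1)))
    (hZ : ∀ m : ℕ, (∀ κ κ' κ₁ κ₂, zmode Lc (fun κ u κ' u' =>
        (cE₂ * (Lc : ℝ) ^ (2 * (3 + 1))) •
            mmRead Lc (K3OfK (unitK (sfStep Lc m) (smStep 3 Lc m) (KInvStep (d := 3) Lc m)) Lc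
              (unitS (sfStep Lc m) (smStep 3 Lc m) (Spure 3 Lc cE cVH cΛ m)) (unitM (sfStep Lc m) (smStep 3 Lc m) (M1 3 Lc cΛ m))
              (W2SymOfK (unitK (sfStep Lc m) (smStep 3 Lc m) (KInvStep (d := 3) Lc m)) Lc
                (unitS (sfStep Lc m) (smStep 3 Lc m) (Spure 3 Lc cE cVH cΛ m)) (unitM (sfStep Lc m) (smStep 3 Lc m) (M1 3 Lc cΛ m)) 0
                (unitM₂ (sfStep Lc m) (smStep 3 Lc m) (M2Of 3 Lc mixFF m))) κ u κ' u')
          + cB • mfNeg ((vh₂SAt (toSite r) Lc) κ u κ' u')) κ κ' (Sum.inl κ₁) (Sum.inl κ₂) + zmode Lc (fun κ u κ' u' =>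
        (cE₂ * (Lc : ℝ) ^ (2 * (3 + 1))) •
            mmRead Lc (K3OfK (unitK (sfStep Lc m) (smStep 3 Lc m) (KInvStep (d := 3) Lc m)) Lc
              (unitS (sfStep Lc m) (smStep 3 Lc m) (Spure 3 Lc cE cVH cΛ m)) (unitM (sfStep Lc m) (smStep 3 Lc m) (M1 3 Lc cΛ m))
              (W2SymOfK (unitK (sfStep Lc m) (smStep 3 Lc m) (KInvStep (d := 3) Lc m)) Lc
                (unitS (sfStep Lc m) (smStep 3 Lc m) (Spure 3 Lc cE cVH cΛ m)) (unitM (sfStep Lc m) (smStep 3 Lc m) (M1 3 Lc cΛ m)) 0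
                (unitM₂ (sfStep Lc m) (smStep 3 Lc m) (M2Of 3 Lc mixFF m))) κ u κ' u')
          + cB • mfNeg ((vh₂SAt (toSite r) Lc) κ u κ' u')) κ' κ (Sum.inl κ₁) (Sum.inl κ₂) = 0))
    (hZ0 : (∀ κ κ' κ₁ κ₂, zmode Lc (fun κ u κ' u' => unitS₂ (sfStep Lc 1) (smStep 3 Lc 1) (T2Of 3 Lc cE cVH cΛ cE₂ cB Tc (vh₂SAt (toSite r) Lc) mixFF 1) κ u κ' u' - unitS₂ (sfStep Lc 0) (smStep 3 Lc 0) (T2Of 3 Lc cE cVH cΛ cE₂ cB Tc (vh₂SAt (toSite r) Lc) mixFF 0) κ u κ' u') κ κ' (Sum.inl κ₁) (Sum.inl κ₂) + zmode Lc (fun κ u κ' u' => unitS₂ (sfStep Lc 1) (smStep 3 Lc 1) (T2Of 3 Lc cE cVH cΛ cE₂ cB Tc (vh₂SAt (toSite r) Lc) mixFF 1) κ u κ' u' - unitS₂ (sfStep Lc 0) (smStep 3 Lc 0) (T2Of 3 Lc cE cVH cΛ cE₂ cB Tc (vh₂SAt (toSite r) Lc) mixFF 0) κ u κ' u') κ'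 κ (Sum.inl κ₁) (Sum.inl κ₂) = 0)) :
    ∃ c ϑ δT : ℝ, 0 ≤ c ∧ 0 < ϑ ∧ ϑ < 1 ∧ 0 < δT ∧
      (∀ n, LocStencil₂ (fun κ u κ' u' => unitS₂ (sfStep Lc (n + 1)) (smStep 3 Lc (n + 1)) (T2Of 3 Lc cE cVH cΛ cE₂ cB Tc (vh₂SAt (toSite r) Lc) mixFF (n + 1)) κ u κ' u' - unitS₂ (sfStep Lc n) (smStep 3 Lc n) (T2Of 3 Lc cE cVH cΛ cE₂ cB Tc (vh₂SAt (toSite r) Lc) mixFF n) κ u κ' u') (c * ϑ ^ n) δT) ∧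
      (∀ k j, LocStencil₂ (fun κ u κ' u' => unitS₂ (sfStep Lc (k + j)) (smStep 3 Lc (k + j)) (T2Of 3 Lc cE cVH cΛ cE₂ cB Tc (vh₂SAt (toSite r) Lc) mixFF (k + j)) κ u κ' u' - unitS₂ (sfStep Lc k) (smStep 3 Lc k) (T2Of 3 Lc cE cVH cΛ cE₂ cB Tc (vh₂SAt (toSite r) Lc) mixFF k) κ u κ' u') (c * (1 - ϑ)⁻¹ * ϑ ^ k) δT) ∧
      (∀ n κ u κ' u' x z a b, |unitS₂ (sfStep Lc (n + 1)) (smStep 3 Lc (n + 1)) (T2Of 3 Lc cE cVH cΛ cE₂ cB Tc (vh₂SAt (toSite r) Lc) mixFF (n + 1)) κ u κ' u' x z a b - unitS₂ (sfStep Lc n) (smStep 3 Lc n) (T2Of 3 Lc cE cVH cΛ cE₂ cB Tc (vh₂SAt (toSite r) Lc) mixFF n) κ u κ' u' x z a b| ≤ c * ϑ ^ n) := by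
  have hLc1 : 1 ≤ Lc := one_le_of_two_le hLc
  obtain ⟨C, δ, cK, θK, hδ, -, -, hK, -⟩ := convCKWall_holds (Lc := Lc) hLc
  obtain ⟨Cf, θ, δf, hCf, hθ0, hθ1, hδf, hf⟩ := hf_three_of_F2asym hLc hr cE cVH cΛ cE₂ cB Tc hmix hδ₄ hfm hm hmixt hpin hZ
  obtain ⟨C₀, δ₀, hδ₀, h0⟩ := hD0_pair (d := 3) hLc1 cE cVH cΛ cE₂ cB Tc (hB_an1 hLc1 hr) ⟨CM₂, δ₄, hδ₄, hmix⟩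
  obtain ⟨Cb, δb, hCb, hδb, hb⟩ := hb_three_at hLc hr cE cVH cΛ cE₂ cB hmix hδ₄ hfm hm
  obtain ⟨CT', δT, hCT', hδT, -, hTi⟩ := hTirr_three_symZ_slot hLc1 hK hδ cE₂ (lt_min hδf hδ₀) (fun _ => (0 : ℝ))
  obtain ⟨c, ϑ, hc, hϑ0, hϑ1, h1, h2, h3⟩ := t2Drift_of_rows_at (d := 3) cE cVH cΛ cE₂ cB Tc mixFF
    (fun m => ((lin4 (cE₂ * (Lc : ℝ) ^ (2 * (3 + 1))) (unitK (sfStep Lc (m + 1)) (smStep 3 Lc (m + 1)) (KInvStep (d := 3) Lc (m + 1))) Lc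
              (unitS₂ (sfStep Lc m) (smStep 3 Lc m) (T2Of 3 Lc cE cVH cΛ cE₂ cB Tc (vh₂SAt (toSite r) Lc) mixFF m))
          - lin4 (cE₂ * (Lc : ℝ) ^ (2 * (3 + 1))) (unitK (sfStep Lc m) (smStep 3 Lc m) (KInvStep (d := 3) Lc m)) Lc
              (unitS₂ (sfStep Lc m) (smStep 3 Lc m) (T2Of 3 Lc cE cVH cΛ cE₂ cB Tc (vh₂SAt (toSite r) Lc) mixFF m)))
        + ((fun κ u κ' u' =>
        (cE₂ * (Lc : ℝ) ^ (2 * (3 + 1))) •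
            mmRead Lc (K3OfK (unitK (sfStep Lc (m + 1)) (smStep 3 Lc (m + 1)) (KInvStep (d := 3) Lc (m + 1))) Lc
              (unitS (sfStep Lc (m + 1)) (smStep 3 Lc (m + 1)) (Spure 3 Lc cE cVH cΛ (m + 1))) (unitM (sfStep Lc (m + 1)) (smStep 3 Lc (m + 1)) (M1 3 Lc cΛ (m + 1)))
              (W2SymOfK (unitK (sfStep Lc (m + 1)) (smStep 3 Lc (m + 1)) (KInvStep (d := 3) Lc (m + 1))) Lc
                (unitS (sfStep Lc (m + 1)) (smStep 3 Lc (m + 1)) (Spure 3 Lc cE cVH cΛ (m + 1))) (unitM (sfStep Lc (m + 1)) (smStep 3 Lc (m + 1)) (M1 3 Lc cΛ (m + 1))) 0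
                (unitM₂ (sfStep Lc (m + 1)) (smStep 3 Lc (m + 1)) (M2Of 3 Lc mixFF (m + 1)))) κ u κ' u')
          + cB • mfNeg ((vh₂SAt (toSite r) Lc) κ u κ' u'))
          - (fun κ u κ' u' =>
        (cE₂ * (Lc : ℝ) ^ (2 * (3 + 1))) •
            mmRead Lc (K3OfK (unitK (sfStep Lc m) (smStep 3 Lc m) (KInvStep (d := 3) Lc m)) Lc
              (unitS (sfStep Lc m) (smStep 3 Lc m) (Spure 3 Lc cE cVH cΛ m)) (unitM (sfStep Lc m) (smStep 3 Lc m) (M1 3 Lc cΛ m))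
              (W2SymOfK (unitK (sfStep Lc m) (smStep 3 Lc m) (KInvStep (d := 3) Lc m)) Lc
                (unitS (sfStep Lc m) (smStep 3 Lc m) (Spure 3 Lc cE cVH cΛ m)) (unitM (sfStep Lc m) (smStep 3 Lc m) (M1 3 Lc cΛ m)) 0
                (unitM₂ (sfStep Lc m) (smStep 3 Lc m) (M2Of 3 Lc mixFF m))) κ u κ' u')
          + cB • mfNeg ((vh₂SAt (toSite r) Lc) κ u κ' u')))))
    (fun m k => transport (fun j => lin4 (cE₂ * (Lc : ℝ) ^ (2 * (3 + 1))) (unitK (sfStep Lc j) (smStep 3 Lc j) (KInvStep (d := 3) Lc j)) Lc) (m + 1) k)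
    (fun X => (∀ κ u κ' u' t, X κ (u + (Lc : ℤ) • t) κ' (u' + (Lc : ℤ) • t) = shiftK (-((Lc : ℤ) • t)) (X κ u κ' u')) ∧
      (∀ κ κ' κ₁ κ₂, zmode Lc X κ κ' (Sum.inl κ₁) (Sum.inl κ₂) + zmode Lc X κ' κ (Sum.inl κ₁) (Sum.inl κ₂) = 0))
    (fun _ => (0 : ℝ)) hδT hCT' inv_natCast_nonneg (inv_natCast_lt_one hLc) hθ0 hθ1
    (fun n => unitS₂_T2Of_sub_eq_transport_add_sum_vh₂SAt_of_mix cE cVH cΛ cE₂ cB Tc mixFF hLc1 hr ⟨CM₂, δ₄, hδ₄, hmix⟩ n)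
    (fun m k X C' hC hX hZX hmX => hTi hpin (m + 1) k X C' hC hX hZX hmX)
    (hf (min_le_left _ _))
    (fun m => forcing_zfreeSym_of_source (d := 3) hLc1 hr cE cVH cΛ cE₂ cB Tc ⟨CM₂, δ₄, hδ₄, hmix⟩ hmixt
      (fun j => (fun κ u κ' u' =>
        (cE₂ * (Lc : ℝ) ^ (2 * (3 + 1))) •
            mmRead Lc (K3OfK (unitK (sfStep Lc j) (smStep 3 Lc j) (KInvStep (d := 3) Lc j)) Lc
              (unitS (sfStep Lc j) (smStep 3 Lc j) (Spure 3 Lc cE cVH cΛ j)) (unitM (sfStep Lc j) (smStep 3 Lc j) (M1 3 Lc cΛ j))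
              (W2SymOfK (unitK (sfStep Lc j) (smStep 3 Lc j) (KInvStep (d := 3) Lc j)) Lc
                (unitS (sfStep Lc j) (smStep 3 Lc j) (Spure 3 Lc cE cVH cΛ j)) (unitM (sfStep Lc j) (smStep 3 Lc j) (M1 3 Lc cΛ j)) 0
                (unitM₂ (sfStep Lc j) (smStep 3 Lc j) (M2Of 3 Lc mixFF j))) κ u κ' u')
          + cB • mfNeg ((vh₂SAt (toSite r) Lc) κ u κ' u')))
      (fun j κ u κ' u' t => bracket_translate_block (d := 3) hLc1 cE cVH cΛ hmixt (hBt_an1 hLc1 (toSite r)) cE₂ cB j κ u κ' u' t)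
      hδb (fun j => (hb le_rfl j).1) hZ m)
    (h0 _ (min_le_right _ _))
    ⟨fun κ u κ' u' t => T2diff_translate_of (d := 3) hLc1 cE cVH cΛ cE₂ cB Tc (hBt_an1 hLc1 (toSite r)) hmixt 0 κ u κ' u' t, hZ0⟩
  exact ⟨c, ϑ, δT, hc, hϑ0, hϑ1, hδT, h1, h2, h3⟩

end Three

/-! ## §2 an1's mixed table at a box root (the `ZfreeSym` currency; covariance and ROWS-MIX are free) -/

section An1

variable {Lc : ℕ} [NeZero Lc] {r : Fin (3 + 1) → ℕ}

/-- **END #2 COMPOSED BY NAME FOR an1's MIXED TABLE `mixFFAt (toSite r) Lc` (`r ∈ box (3+1) Lc`), `ZfreeSym` currency**: «T2Drift» ⇐ pin ∧ ROW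
W3-F2a's bond-symmetrised cell charges ∧ the bond-symmetrised cell charge of the first difference (ROWS-MIX and `hmixt` by
`MixedJetTablesPlug.hmix_an1` ∕ `hmixt_an1`, `WSlotMixedShape.mixFFAt_hfm` ∕ `mixFFAt_hm`). -/
theorem t2Drift_three_an1_of_F2asym_Z0sym (hLc : 2 ≤ Lc) (hr : r ∈ box (3 + 1) Lc) (cE cVH cΛ cE₂ cB : ℝ)
    (Tc : Fin 4 → Fin 4 → Fin 4 → Fin 4 → ℝ)
    (hpin : |cE₂| ≤ (Lc : ℝ) ^ (2 * (3 + 1)))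
    (hZ : ∀ m : ℕ, (∀ κ κ' κ₁ κ₂, zmode Lc (fun κ u κ' u' =>
        (cE₂ * (Lc : ℝ) ^ (2 * (3 + 1))) •
            mmRead Lc (K3OfK (unitK (sfStep Lc m) (smStep 3 Lc m) (KInvStep (d := 3) Lc m)) Lc
              (unitS (sfStep Lc m) (smStep 3 Lc m) (Spure 3 Lc cE cVH cΛ m)) (unitM (sfStep Lc m) (smStep 3 Lc m) (M1 3 Lc cΛ m))
              (W2SymOfK (unitK (sfStep Lc m) (smStep 3 Lc m) (KInvStep (d := 3) Lc m)) Lc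
                (unitS (sfStep Lc m) (smStep 3 Lc m) (Spure 3 Lc cE cVH cΛ m)) (unitM (sfStep Lc m) (smStep 3 Lc m) (M1 3 Lc cΛ m)) 0
                (unitM₂ (sfStep Lc m) (smStep 3 Lc m) (M2Of 3 Lc (mixFFAt (toSite r) Lc) m))) κ u κ' u')
          + cB • mfNeg ((vh₂SAt (toSite r) Lc) κ u κ' u')) κ κ' (Sum.inl κ₁) (Sum.inl κ₂) + zmode Lc (fun κ u κ' u' =>
        (cE₂ * (Lc : ℝ) ^ (2 * (3 + 1))) •
            mmRead Lc (K3OfK (unitK (sfStep Lc m) (smStep 3 Lc m) (KInvStep (d := 3) Lc m)) Lc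
              (unitS (sfStep Lc m) (smStep 3 Lc m) (Spure 3 Lc cE cVH cΛ m)) (unitM (sfStep Lc m) (smStep 3 Lc m) (M1 3 Lc cΛ m))
              (W2SymOfK (unitK (sfStep Lc m) (smStep 3 Lc m) (KInvStep (d := 3) Lc m)) Lc
                (unitS (sfStep Lc m) (smStep 3 Lc m) (Spure 3 Lc cE cVH cΛ m)) (unitM (sfStep Lc m) (smStep 3 Lc m) (M1 3 Lc cΛ m)) 0
                (unitM₂ (sfStep Lc m) (smStep 3 Lc m) (M2Of 3 Lc (mixFFAt (toSite r) Lc) m))) κ u κ' u')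
          + cB • mfNeg ((vh₂SAt (toSite r) Lc) κ u κ' u')) κ' κ (Sum.inl κ₁) (Sum.inl κ₂) = 0))
    (hZ0 : (∀ κ κ' κ₁ κ₂, zmode Lc (fun κ u κ' u' => unitS₂ (sfStep Lc 1) (smStep 3 Lc 1) (T2Of 3 Lc cE cVH cΛ cE₂ cB Tc (vh₂SAt (toSite r) Lc) (mixFFAt (toSite r) Lc) 1) κ u κ' u' - unitS₂ (sfStep Lc 0) (smStep 3 Lc 0) (T2Of 3 Lc cE cVH cΛ cE₂ cB Tc (vh₂SAt (toSite r) Lc) (mixFFAt (toSite r) Lc) 0) κ u κ' u') κ κ' (Sum.inl κ₁) (Sum.inl κ₂) + zmode Lc (fun κ u κ' u' => unitS₂ (sfStep Lc 1) (smStep 3 Lc 1) (T2Of 3 Lc cE cVH cΛ cE₂ cB Tc (vh₂SAt (toSite r) Lc) (mixFFAt (toSite r) Lc) 1) κ u κ' u' - unitS₂ (sfStep Lc 0) (smStep 3 Lc 0) (T2Of 3 Lc cE cVH cΛ cE₂ cB Tc (vh₂SAt (toSite r) Lc) (mixFFAt (toSite r) Lc) 0) κ u κ' u') κ' κ (Sum.inl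 κ₁) (Sum.inl κ₂) = 0)) :
    ∃ c ϑ δT : ℝ, 0 ≤ c ∧ 0 < ϑ ∧ ϑ < 1 ∧ 0 < δT ∧
      (∀ n, LocStencil₂ (fun κ u κ' u' => unitS₂ (sfStep Lc (n + 1)) (smStep 3 Lc (n + 1)) (T2Of 3 Lc cE cVH cΛ cE₂ cB Tc (vh₂SAt (toSite r) Lc) (mixFFAt (toSite r) Lc) (n + 1)) κ u κ' u' - unitS₂ (sfStep Lc n) (smStep 3 Lc n) (T2Of 3 Lc cE cVH cΛ cE₂ cB Tc (vh₂SAt (toSite r) Lc) (mixFFAt (toSite r) Lc) n) κ u κ' u') (c * ϑ ^ n) δT) ∧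
      (∀ k j, LocStencil₂ (fun κ u κ' u' => unitS₂ (sfStep Lc (k + j)) (smStep 3 Lc (k + j)) (T2Of 3 Lc cE cVH cΛ cE₂ cB Tc (vh₂SAt (toSite r) Lc) (mixFFAt (toSite r) Lc) (k + j)) κ u κ' u' - unitS₂ (sfStep Lc k) (smStep 3 Lc k) (T2Of 3 Lc cE cVH cΛ cE₂ cB Tc (vh₂SAt (toSite r) Lc) (mixFFAt (toSite r) Lc) k) κ u κ' u') (c * (1 - ϑ)⁻¹ * ϑ ^ k) δT) ∧
      (∀ n κ u κ' u' x z a b, |unitS₂ (sfStep Lc (n + 1)) (smStep 3 Lc (n + 1)) (T2Of 3 Lc cE cVH cΛ cE₂ cB Tc (vh₂SAt (toSite r) Lc) (mixFFAt (toSite r) Lc) (n + 1)) κ u κ' u' x z a b - unitS₂ (sfStep Lc n) (smStep 3 Lc n) (T2Of 3 Lc cE cVH cΛ cE₂ cB Tc (vh₂SAt (toSite r) Lc) (mixFFAt (toSite r) Lc) n) κ u κ' u' x z a b| ≤ c * ϑ ^ n) := by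
  obtain ⟨CM₂, δ₄, hδ₄, hmix⟩ := hmix_an1 (d := 3) (Lc := Lc) (one_le_of_two_le hLc) hr
  exact t2Drift_three_of_F2asym_Z0sym hLc hr cE cVH cΛ cE₂ cB Tc hmix hδ₄ (mixFFAt_hfm _) (mixFFAt_hm _) (hmixt_an1 (toSite r)) hpin hZ hZ0

end An1

/-! ## §3 Both ENDs at once in the `ZfreeSym` currency (one `obtain` for an assembler) -/

section Both

variable {Lc : ℕ} [NeZero Lc] {r : Fin (3 + 1) → ℕ}

/-- **«T2Shape» ∧ «T2Drift» AT `d = 3`, generic block-covariant mixed table, MODULO ROW W3-F2a (bond-symmetrised cell charges), ROW W3-F4d's pin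
half (same currency) AND THE PIN** [folklore conjunction: leaf-12's `T2ShapeThreeOfF2a.t2Shape_three_of_F2a_symZ` (covariance by
`bracket_translate_block_base`) ∧ `t2Drift_three_of_F2asym_Z0sym`]. -/
theorem t2ShapeDrift_three_of_F2asym_Z0sym (hLc : 2 ≤ Lc) (hr : r ∈ box (3 + 1) Lc) (cE cVH cΛ cE₂ cB : ℝ) (Tc : Fin 4 → Fin 4 → Fin 4 → Fin 4 → ℝ)
    {mixFF : BiTab 3} {CM₂ δ₄ : ℝ} (hmix : LocStencilFM Lc mixFF CM₂ δ₄) (hδ₄ : 0 < δ₄)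
    (hfm : ∀ κ u ρ w x z (α μ' : Fin (3 + 1)), mixFF κ u ρ w x z (Sum.inl α) (Sum.inr μ') = 0)
    (hm : ∀ κ u ρ w x z (μ' : Fin (3 + 1)) (b : Fib 3), mixFF κ u ρ w x z (Sum.inr μ') b = 0)
    (hmixt : ∀ (κ : Fin (3 + 1)) (u : Fin (3 + 1) → ℤ) (ρ : Fin (3 + 1)) (w t : Fin (3 + 1) → ℤ),
      mixFF κ (u + (Lc : ℤ) • t) ρ (w + t) = shiftK (-((Lc : ℤ) • t)) (mixFF κ u ρ w))
    (hpin : |cE₂| ≤ (Lc : ℝ) ^ (2 * (3 + 1)))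
    (hZ : ∀ m : ℕ, (∀ κ κ' κ₁ κ₂, zmode Lc (fun κ u κ' u' =>
        (cE₂ * (Lc : ℝ) ^ (2 * (3 + 1))) •
            mmRead Lc (K3OfK (unitK (sfStep Lc m) (smStep 3 Lc m) (KInvStep (d := 3) Lc m)) Lc
              (unitS (sfStep Lc m) (smStep 3 Lc m) (Spure 3 Lc cE cVH cΛ m)) (unitM (sfStep Lc m) (smStep 3 Lc m) (M1 3 Lc cΛ m))
              (W2SymOfK (unitK (sfStep Lc m) (smStep 3 Lc m) (KInvStep (d := 3) Lc m)) Lc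
                (unitS (sfStep Lc m) (smStep 3 Lc m) (Spure 3 Lc cE cVH cΛ m)) (unitM (sfStep Lc m) (smStep 3 Lc m) (M1 3 Lc cΛ m)) 0
                (unitM₂ (sfStep Lc m) (smStep 3 Lc m) (M2Of 3 Lc mixFF m))) κ u κ' u')
          + cB • mfNeg ((vh₂SAt (toSite r) Lc) κ u κ' u')) κ κ' (Sum.inl κ₁) (Sum.inl κ₂) + zmode Lc (fun κ u κ' u' =>
        (cE₂ * (Lc : ℝ) ^ (2 * (3 + 1))) •
            mmRead Lc (K3OfK (unitK (sfStep Lc m) (smStep 3 Lc m) (KInvStep (d := 3) Lc m)) Lc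
              (unitS (sfStep Lc m) (smStep 3 Lc m) (Spure 3 Lc cE cVH cΛ m)) (unitM (sfStep Lc m) (smStep 3 Lc m) (M1 3 Lc cΛ m))
              (W2SymOfK (unitK (sfStep Lc m) (smStep 3 Lc m) (KInvStep (d := 3) Lc m)) Lc
                (unitS (sfStep Lc m) (smStep 3 Lc m) (Spure 3 Lc cE cVH cΛ m)) (unitM (sfStep Lc m) (smStep 3 Lc m) (M1 3 Lc cΛ m)) 0
                (unitM₂ (sfStep Lc m) (smStep 3 Lc m) (M2Of 3 Lc mixFF m))) κ u κ' u')
          + cB • mfNeg ((vh₂SAt (toSite r) Lc) κ u κ' u')) κ' κ (Sum.inl κ₁) (Sum.inl κ₂) = 0))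
    (hZ0 : (∀ κ κ' κ₁ κ₂, zmode Lc (fun κ u κ' u' => unitS₂ (sfStep Lc 1) (smStep 3 Lc 1) (T2Of 3 Lc cE cVH cΛ cE₂ cB Tc (vh₂SAt (toSite r) Lc) mixFF 1) κ u κ' u' - unitS₂ (sfStep Lc 0) (smStep 3 Lc 0) (T2Of 3 Lc cE cVH cΛ cE₂ cB Tc (vh₂SAt (toSite r) Lc) mixFF 0) κ u κ' u') κ κ' (Sum.inl κ₁) (Sum.inl κ₂) + zmode Lc (fun κ u κ' u' => unitS₂ (sfStep Lc 1) (smStep 3 Lc 1) (T2Of 3 Lc cE cVH cΛ cE₂ cB Tc (vh₂SAt (toSite r) Lc) mixFF 1) κ u κ' u' - unitS₂ (sfStep Lc 0) (smStep 3 Lc 0) (T2Of 3 Lc cE cVH cΛ cE₂ cB Tc (vh₂SAt (toSite r) Lc) mixFF 0) κ u κ' u') κ' κ (Sum.inl κ₁) (Sum.inl κ₂) = 0)) :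
    (∃ C₂ δ₂ : ℝ, 0 < δ₂ ∧ ∀ j, LocStencil₂ (unitS₂ (sfStep Lc j) (smStep 3 Lc j) (T2Of 3 Lc cE cVH cΛ cE₂ cB Tc (vh₂SAt (toSite r) Lc) mixFF j)) C₂ δ₂) ∧
    (∃ c ϑ δT : ℝ, 0 ≤ c ∧ 0 < ϑ ∧ ϑ < 1 ∧ 0 < δT ∧
      (∀ n, LocStencil₂ (fun κ u κ' u' => unitS₂ (sfStep Lc (n + 1)) (smStep 3 Lc (n + 1)) (T2Of 3 Lc cE cVH cΛ cE₂ cB Tc (vh₂SAt (toSite r) Lc) mixFF (n + 1)) κ u κ' u' - unitS₂ (sfStep Lc n) (smStep 3 Lc n) (T2Of 3 Lc cE cVH cΛ cE₂ cB Tc (vh₂SAt (toSite r) Lc) mixFF n) κ u κ' u') (c * ϑ ^ n) δT) ∧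
      (∀ k j, LocStencil₂ (fun κ u κ' u' => unitS₂ (sfStep Lc (k + j)) (smStep 3 Lc (k + j)) (T2Of 3 Lc cE cVH cΛ cE₂ cB Tc (vh₂SAt (toSite r) Lc) mixFF (k + j)) κ u κ' u' - unitS₂ (sfStep Lc k) (smStep 3 Lc k) (T2Of 3 Lc cE cVH cΛ cE₂ cB Tc (vh₂SAt (toSite r) Lc) mixFF k) κ u κ' u') (c * (1 - ϑ)⁻¹ * ϑ ^ k) δT) ∧
      (∀ n κ u κ' u' x z a b, |unitS₂ (sfStep Lc (n + 1)) (smStep 3 Lc (n + 1)) (T2Of 3 Lc cE cVH cΛ cE₂ cB Tc (vh₂SAt (toSite r) Lc) mixFF (n + 1)) κ u κ' u' x z a b - unitS₂ (sfStep Lc n) (smStep 3 Lc n) (T2Of 3 Lc cE cVH cΛ cE₂ cB Tc (vh₂SAt (toSite r) Lc) mixFF n) κ u κ' u' x z a b| ≤ c * ϑ ^ n)) :=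
  ⟨t2Shape_three_of_F2a_symZ hLc hr cE cVH cΛ cE₂ cB Tc hmix hδ₄ hfm hm hpin
      (fun m => ⟨fun κ u κ' u' t => bracket_translate_block (d := 3) (one_le_of_two_le hLc) cE cVH cΛ hmixt (hBt_an1 (one_le_of_two_le hLc) (toSite r)) cE₂ cB m κ u κ' u' t, hZ m⟩),
    t2Drift_three_of_F2asym_Z0sym hLc hr cE cVH cΛ cE₂ cB Tc hmix hδ₄ hfm hm hmixt hpin hZ hZ0⟩

/-- **«T2Shape» ∧ «T2Drift» AT `d = 3` FOR an1's MIXED TABLE `mixFFAt (toSite r) Lc` (`r ∈ box (3+1) Lc`), `ZfreeSym` currency, MODULO ROW W3-F2a,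
ROW W3-F4d's pin half AND THE PIN** [folklore conjunction: leaf-12's `t2Shape_three_an1_of_F2a_symZ` ∧ §2]. -/
theorem t2ShapeDrift_three_an1_of_F2asym_Z0sym (hLc : 2 ≤ Lc) (hr : r ∈ box (3 + 1) Lc) (cE cVH cΛ cE₂ cB : ℝ)
    (Tc : Fin 4 → Fin 4 → Fin 4 → Fin 4 → ℝ)
    (hpin : |cE₂| ≤ (Lc : ℝ) ^ (2 * (3 + 1)))
    (hZ : ∀ m : ℕ, (∀ κ κ' κ₁ κ₂, zmode Lc (fun κ u κ' u' =>
        (cE₂ * (Lc : ℝ) ^ (2 * (3 + 1))) •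
            mmRead Lc (K3OfK (unitK (sfStep Lc m) (smStep 3 Lc m) (KInvStep (d := 3) Lc m)) Lc
              (unitS (sfStep Lc m) (smStep 3 Lc m) (Spure 3 Lc cE cVH cΛ m)) (unitM (sfStep Lc m) (smStep 3 Lc m) (M1 3 Lc cΛ m))
              (W2SymOfK (unitK (sfStep Lc m) (smStep 3 Lc m) (KInvStep (d := 3) Lc m)) Lc
                (unitS (sfStep Lc m) (smStep 3 Lc m) (Spure 3 Lc cE cVH cΛ m)) (unitM (sfStep Lc m) (smStep 3 Lc m) (M1 3 Lc cΛ m)) 0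
                (unitM₂ (sfStep Lc m) (smStep 3 Lc m) (M2Of 3 Lc (mixFFAt (toSite r) Lc) m))) κ u κ' u')
          + cB • mfNeg ((vh₂SAt (toSite r) Lc) κ u κ' u')) κ κ' (Sum.inl κ₁) (Sum.inl κ₂) + zmode Lc (fun κ u κ' u' =>
        (cE₂ * (Lc : ℝ) ^ (2 * (3 + 1))) •
            mmRead Lc (K3OfK (unitK (sfStep Lc m) (smStep 3 Lc m) (KInvStep (d := 3) Lc m)) Lc
              (unitS (sfStep Lc m) (smStep 3 Lc m) (Spure 3 Lc cE cVH cΛ m)) (unitM (sfStep Lc m) (smStep 3 Lc m) (M1 3 Lc cΛ m))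
              (W2SymOfK (unitK (sfStep Lc m) (smStep 3 Lc m) (KInvStep (d := 3) Lc m)) Lc
                (unitS (sfStep Lc m) (smStep 3 Lc m) (Spure 3 Lc cE cVH cΛ m)) (unitM (sfStep Lc m) (smStep 3 Lc m) (M1 3 Lc cΛ m)) 0
                (unitM₂ (sfStep Lc m) (smStep 3 Lc m) (M2Of 3 Lc (mixFFAt (toSite r) Lc) m))) κ u κ' u')
          + cB • mfNeg ((vh₂SAt (toSite r) Lc) κ u κ' u')) κ' κ (Sum.inl κ₁) (Sum.inl κ₂) = 0))
    (hZ0 : (∀ κ κ' κ₁ κ₂, zmode Lc (fun κ u κ' u' => unitS₂ (sfStep Lc 1) (smStep 3 Lc 1) (T2Of 3 Lc cE cVH cΛ cE₂ cB Tc (vh₂SAt (toSite r) Lc) (mixFFAt (toSite r) Lc) 1) κ u κ' u' - unitS₂ (sfStep Lc 0) (smStep 3 Lc 0) (T2Of 3 Lc cE cVH cΛ cE₂ cB Tc (vh₂SAt (toSite r) Lc) (mixFFAt (toSite r) Lc) 0) κ u κ' u') κ κ' (Sum.inl κ₁) (Sum.inl κ₂) + zmode Lc (fun κ u κ' u' =>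 unitS₂ (sfStep Lc 1) (smStep 3 Lc 1) (T2Of 3 Lc cE cVH cΛ cE₂ cB Tc (vh₂SAt (toSite r) Lc) (mixFFAt (toSite r) Lc) 1) κ u κ' u' - unitS₂ (sfStep Lc 0) (smStep 3 Lc 0) (T2Of 3 Lc cE cVH cΛ cE₂ cB Tc (vh₂SAt (toSite r) Lc) (mixFFAt (toSite r) Lc) 0) κ u κ' u') κ' κ (Sum.inl κ₁) (Sum.inl κ₂) = 0)) :
    (∃ C₂ δ₂ : ℝ, 0 < δ₂ ∧ ∀ j, LocStencil₂ (unitS₂ (sfStep Lc j) (smStep 3 Lc j) (T2Of 3 Lc cE cVH cΛ cE₂ cB Tc (vh₂SAt (toSite r) Lc) (mixFFAt (toSite r) Lc) j)) C₂ δ₂) ∧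
    (∃ c ϑ δT : ℝ, 0 ≤ c ∧ 0 < ϑ ∧ ϑ < 1 ∧ 0 < δT ∧
      (∀ n, LocStencil₂ (fun κ u κ' u' => unitS₂ (sfStep Lc (n + 1)) (smStep 3 Lc (n + 1)) (T2Of 3 Lc cE cVH cΛ cE₂ cB Tc (vh₂SAt (toSite r) Lc) (mixFFAt (toSite r) Lc) (n + 1)) κ u κ' u' - unitS₂ (sfStep Lc n) (smStep 3 Lc n) (T2Of 3 Lc cE cVH cΛ cE₂ cB Tc (vh₂SAt (toSite r) Lc) (mixFFAt (toSite r) Lc) n) κ u κ' u') (c * ϑ ^ n) δT) ∧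
      (∀ k j, LocStencil₂ (fun κ u κ' u' => unitS₂ (sfStep Lc (k + j)) (smStep 3 Lc (k + j)) (T2Of 3 Lc cE cVH cΛ cE₂ cB Tc (vh₂SAt (toSite r) Lc) (mixFFAt (toSite r) Lc) (k + j)) κ u κ' u' - unitS₂ (sfStep Lc k) (smStep 3 Lc k) (T2Of 3 Lc cE cVH cΛ cE₂ cB Tc (vh₂SAt (toSite r) Lc) (mixFFAt (toSite r) Lc) k) κ u κ' u') (c * (1 - ϑ)⁻¹ * ϑ ^ k) δT) ∧
      (∀ n κ u κ' u' x z a b, |unitS₂ (sfStep Lc (n + 1)) (smStep 3 Lc (n + 1)) (T2Of 3 Lc cE cVH cΛ cE₂ cB Tc (vh₂SAt (toSite r) Lc) (mixFFAt (toSite r) Lc) (n + 1)) κ u κ' u' x z a b - unitS₂ (sfStep Lc n) (smStep 3 Lc n) (T2Of 3 Lc cE cVH cΛ cE₂ cB Tc (vh₂SAt (toSite r) Lc) (mixFFAt (toSite r) Lc) n) κ u κ' u' x z a b| ≤ c * ϑ ^ n)) :=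
  ⟨t2Shape_three_an1_of_F2a_symZ hLc hr cE cVH cΛ cE₂ cB Tc hpin hZ,
    t2Drift_three_an1_of_F2asym_Z0sym hLc hr cE cVH cΛ cE₂ cB Tc hpin hZ hZ0⟩

end Both

end Summit.QuantumFields.BalabanUV.Beta.GAN24.W3DriftOfZSRoot

end
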